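import Summits.BirchSwinnertonDyer.BirchSwinnertonDyer.Theorems.ManinLocalTwoThreeShimuraTwoCharOfPeriods
import HarnessLib

/-!
# Two Shimura classes at every level whose unit group is «cyclic up to sign AND SQUARES»: `(ℤ/uv)ˣ = {± u₀^k s²}`
Summit `BirchSwinnertonDyer`, route `ManinLocalTwoThree` (cell bsd-f2-manin), deciding crux C2 `ManinOddAtFour` (stmt-BirchSwinnertonDyer-22967);
lead p1 gen 15.  Sharpening of `…ShimuraQuotientCuspidalInertia.exists_eq_natCast_mul_cuspSymbol_add_of_generator_mod`: since `2Λ₀(f) ⊆ Λ₁(f)` at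
`4 ∣ N`, SQUARES of units are invisible to the period class, so the generator hypothesis may be weakened to «every unit of `ℤ/uv` is
`± u₀^k · s²`» — i.e. `((ℤ/uv)ˣ/{±1}) ⊗ 𝔽₂` has rank `≤ 1` (the census's "rank-1 levels": `4pq` with `p` or `q ≡ 3 (mod 4)`, `8p, 16p, 4p, 2^e`,
… — 489 of the 913 levels `4 ∣ N ≤ 5000` with squarefree odd part, HOME/p1/g15/CENSUS-shimura-levels-p1-g15.md).
* `exists_eq_natCast_mul_cuspSymbol_add_of_generator_sq_mod` — `N = u²v`, `2Λ₀ ⊆ Λ₁`, units of `ℤ/uv` `= ± u₀^k s²`, `d_{γ₀} ≡ u₀` ⟹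
  `Λ₀(f) = ℤ·{∞, γ₀∞}_f + Λ₁(f)`;
* `exists_forall_mem_or_sub_mem_periodLatticeGamma1_of_generator_sq_mod` — hence at most TWO classes;
* `exists_jacobiSym_represents_of_generator_sq_mod[_of_isNewform0]` — hence (via `…ShimuraTwoCharOfPeriods`) the period class is a KRONECKER
  symbol `(q | d_γ)` at every such level (`4 ∣ N`).
(Index `≠ 4` for lattice-optimal data then follows from `…ShimuraQuotientLevelInstances.not_index_four_of_two_classes`; not restated here.)
HONEST FRAMING: unconditional structure theorems; C2, Manin's conjecture and BSD are NOT proved.  No definitions, no sorry.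
[cite: LingOesterle1991, §1, Thm. 1 and Thm. 6] [cite: Stevens1989, §2]
-/

set_option autoImplicit false
-- the summit-side namespace `Summit.BirchSwinnertonDyer.BirchSwinnertonDyer.…` is the tree's (summit = sub-problem)
set_option linter.dupNamespace false

noncomputable section

open scoped MatrixGroups ModularForm NumberTheorySymbols

open CongruenceSubgroup Literature.NumberTheory.EllipticCurves
  Literature.NumberTheory.EllipticCurves.ModularForms

namespace Summit.BirchSwinnertonDyer.BirchSwinnertonDyer.Theorems.ManinLocalTwoThree

variable {N : ℕ} [NeZero N] (f : CuspForm (Gamma0 N) 2)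

/-- **Cyclic up to sign and squares ⟹ cyclic Shimura quotient** (`N = u²v`, `2Λ₀(f) ⊆ Λ₁(f)`): if every unit of `ℤ/uv` is `± u₀^k·s²` and
`d_{γ₀} ≡ u₀ (mod uv)`, then every period is `k·{∞, γ₀∞}_f` plus a `Γ₁(N)`-period (squares contribute `2·{∞, γ_s∞}_f ∈ Λ₁(f)`).
[cite: LingOesterle1991, §1, Thm. 1 and Thm. 6] -/
theorem exists_eq_natCast_mul_cuspSymbol_add_of_generator_sq_mod {u v : ℕ} (hu : u ≠ 0)
    (hN : (N : ℤ) = (u : ℤ) ^ 2 * v) {u₀ : ZMod (u * v)}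
    (hgen : ∀ w : (ZMod (u * v))ˣ, ∃ (k : ℕ) (s : (ZMod (u * v))ˣ),
      (w : ZMod (u * v)) = u₀ ^ k * (s : ZMod (u * v)) ^ 2 ∨ (w : ZMod (u * v)) = -(u₀ ^ k * (s : ZMod (u * v)) ^ 2))
    (γ₀ : Gamma0 N) (hγ₀ : (((γ₀ : SL(2, ℤ)) 1 1 : ℤ) : ZMod (u * v)) = u₀)
    (h2 : ∀ z ∈ periodLattice f, (2 : ℂ) * z ∈ periodLatticeGamma1 f) {z : ℂ} (hz : z ∈ periodLattice f) :
    ∃ (k : ℕ) (w : ℂ), w ∈ periodLatticeGamma1 f ∧ z = k * cuspSymbol f γ₀ + w := by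
  have hz' : z ∈ (periodLattice f : Set ℂ) := hz
  rw [coe_periodLattice_eq_range] at hz'
  obtain ⟨γ, rfl⟩ := hz'
  obtain ⟨k, s, hk⟩ := hgen (isUnit_apply_one_one_mod hN γ).unit
  rw [IsUnit.unit_spec] at hk
  obtain ⟨γs, hγs⟩ := exists_gamma0_apply_one_one_eq_mod hN (Units.isUnit s)
  -- `d_{γ₀^k γ_s²} ≡ u₀^k s²`
  have hd : ((((γ₀ ^ k * (γs * γs) : Gamma0 N) : SL(2, ℤ)) 1 1 : ℤ) : ZMod (u * v)) =
      u₀ ^ k * (s : ZMod (u * v)) ^ 2 := by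
    have e := apply_one_one_pow_eq_mod hN (γ₀ ^ k * (γs * γs)) 1
    rw [pow_one, pow_one] at e
    have hmul : ∀ γ δ : Gamma0 N, ((((γ * δ : Gamma0 N) : SL(2, ℤ)) 1 1 : ℤ) : ZMod (u * v)) =
        (((γ : SL(2, ℤ)) 1 1 : ℤ) : ZMod (u * v)) * (((δ : SL(2, ℤ)) 1 1 : ℤ) : ZMod (u * v)) := by
      intro γ δ
      have h := congrArg (ZMod.castHom (mul_dvd_of_sq_mul hN) (ZMod (u * v))) (apply_one_one_mul_eq γ δ)
      rwa [map_intCast, map_mul, map_intCast, map_intCast] at h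
    rw [hmul, hmul, apply_one_one_pow_eq_mod hN, hγ₀, hγs]; ring
  have h2s : (2 : ℂ) * cuspSymbol f γs ∈ periodLatticeGamma1 f := h2 _ (cuspSymbol_mem_periodLattice f γs)
  refine ⟨k, cuspSymbol f γ - k * cuspSymbol f γ₀, ?_, by ring⟩
  have hrel : cuspSymbol f γ - cuspSymbol f (γ₀ ^ k * (γs * γs)) ∈ periodLatticeGamma1 f := by
    rcases hk with h | h
    · exact cuspSymbol_sub_mem_periodLatticeGamma1_of_apply_eq_mod f hu hN _ _ (by rw [hd, h])
    · exact cuspSymbol_sub_mem_periodLatticeGamma1_of_apply_eq_neg_mod f hu hN _ _ (by rw [hd, h])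
  have e : cuspSymbol f (γ₀ ^ k * (γs * γs)) = k * cuspSymbol f γ₀ + 2 * cuspSymbol f γs := by
    rw [cuspSymbol_mul_holds f, cuspSymbol_mul_holds f, cuspSymbol_pow_eq_natCast_mul]; ring
  have : cuspSymbol f γ - k * cuspSymbol f γ₀ = (cuspSymbol f γ - cuspSymbol f (γ₀ ^ k * (γs * γs))) + 2 * cuspSymbol f γs := by
    rw [e]; ring
  rw [this]
  exact add_mem hrel h2s

/-- **At most two classes** under the «± u₀^k s²» hypothesis at modulus `uv` and `2Λ₀ ⊆ Λ₁`. [cite: LingOesterle1991, §1 and Thm. 6] -/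
theorem exists_forall_mem_or_sub_mem_periodLatticeGamma1_of_generator_sq_mod {u v : ℕ} (hu : u ≠ 0)
    (hN : (N : ℤ) = (u : ℤ) ^ 2 * v) {u₀ : ZMod (u * v)} (hu₀ : IsUnit u₀)
    (hgen : ∀ w : (ZMod (u * v))ˣ, ∃ (k : ℕ) (s : (ZMod (u * v))ˣ),
      (w : ZMod (u * v)) = u₀ ^ k * (s : ZMod (u * v)) ^ 2 ∨ (w : ZMod (u * v)) = -(u₀ ^ k * (s : ZMod (u * v)) ^ 2))
    (h2 : ∀ z ∈ periodLattice f, (2 : ℂ) * z ∈ periodLatticeGamma1 f) :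
    ∃ γ₀ : Gamma0 N, ∀ z ∈ periodLattice f,
      z ∈ periodLatticeGamma1 f ∨ z - cuspSymbol f γ₀ ∈ periodLatticeGamma1 f := by
  obtain ⟨γ₀, hγ₀⟩ := exists_gamma0_apply_one_one_eq_mod hN hu₀
  refine ⟨γ₀, fun z hz ↦ ?_⟩
  obtain ⟨k, w, hw, rfl⟩ := exists_eq_natCast_mul_cuspSymbol_add_of_generator_sq_mod f hu hN hgen γ₀ hγ₀ h2 hz
  have h2γ : (2 : ℂ) * cuspSymbol f γ₀ ∈ periodLatticeGamma1 f := h2 _ (cuspSymbol_mem_periodLattice f γ₀)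
  have hm : ((k / 2 : ℕ) : ℂ) * ((2 : ℂ) * cuspSymbol f γ₀) ∈ periodLatticeGamma1 f := by
    rw [← nsmul_eq_mul]; exact (periodLatticeGamma1 f).nsmul_mem h2γ _
  rcases Nat.even_or_odd k with ⟨m, hm2⟩ | ⟨m, hm2⟩
  · left
    have hk : (k : ℂ) * cuspSymbol f γ₀ = ((k / 2 : ℕ) : ℂ) * ((2 : ℂ) * cuspSymbol f γ₀) := by
      rw [hm2, show (m + m) / 2 = m by omega]; push_cast; ring
    rw [hk]; exact add_mem hm hw
  · right
    have hk : (k : ℂ) * cuspSymbol f γ₀ + w - cuspSymbol f γ₀ = ((k / 2 : ℕ) : ℂ) * ((2 : ℂ) * cuspSymbol f γ₀) + w := by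
      rw [hm2, show (2 * m + 1) / 2 = m by omega]; push_cast; ring
    rw [hk]; exact add_mem hm hw

/-- **Kronecker at every «rank ≤ 1» level** (`N = u²v`, `4 ∣ N`, units of `ℤ/uv` `= ± u₀^k s²`, `2Λ₀ ⊆ Λ₁`): the period class of `f` is
`(q | d_γ)` for one admissible squarefree `q ∣ N`. [cite: LingOesterle1991, §1, Thm. 1 and Thm. 6] -/
theorem exists_jacobiSym_represents_of_generator_sq_mod {u v m : ℕ} (hu : u ≠ 0)
    (hN : (N : ℤ) = (u : ℤ) ^ 2 * v) (hm : u * v = m) {u₀ : ZMod m} (hu₀ : IsUnit u₀)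
    (hgen : ∀ w : (ZMod m)ˣ, ∃ (k : ℕ) (s : (ZMod m)ˣ),
      (w : ZMod m) = u₀ ^ k * (s : ZMod m) ^ 2 ∨ (w : ZMod m) = -(u₀ ^ k * (s : ZMod m) ^ 2))
    (h2 : ∀ z ∈ periodLattice f, (2 : ℂ) * z ∈ periodLatticeGamma1 f) (h4 : 4 ∣ N) :
    ∃ q : ℕ, Squarefree q ∧ q ∣ N ∧ (¬ 32 ∣ N → Odd q) ∧ (¬ 8 ∣ N → q % 4 = 1) ∧
      ∀ γ : Gamma0 N, cuspSymbol f γ ∈ periodLatticeGamma1 f ↔ J(q | (((γ : SL(2, ℤ)) 1 1 : ℤ)).natAbs) = 1 := by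
  subst hm
  obtain ⟨γ₀, hγ₀⟩ := exists_forall_mem_or_sub_mem_periodLatticeGamma1_of_generator_sq_mod f hu hN hu₀ hgen h2
  exact exists_jacobiSym_represents_of_two_classes f h4 (h2 _ (cuspSymbol_mem_periodLattice f γ₀)) hγ₀

/-- Newform form (`2Λ₀ ⊆ Λ₁` from the traceless prime `2`). [cite: LingOesterle1991, Thm. 6] -/
theorem exists_jacobiSym_represents_of_generator_sq_mod_of_isNewform0 {u v m : ℕ} (hu : u ≠ 0)
    (hN : (N : ℤ) = (u : ℤ) ^ 2 * v) (hm : u * v = m) {u₀ : ZMod m} (hu₀ : IsUnit u₀)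
    (hgen : ∀ w : (ZMod m)ˣ, ∃ (k : ℕ) (s : (ZMod m)ˣ),
      (w : ZMod m) = u₀ ^ k * (s : ZMod m) ^ 2 ∨ (w : ZMod m) = -(u₀ ^ k * (s : ZMod m) ^ 2))
    (hf : IsNewform0 f) (h4 : 4 ∣ N) :
    ∃ q : ℕ, Squarefree q ∧ q ∣ N ∧ (¬ 32 ∣ N → Odd q) ∧ (¬ 8 ∣ N → q % 4 = 1) ∧
      ∀ γ : Gamma0 N, cuspSymbol f γ ∈ periodLatticeGamma1 f ↔ J(q | (((γ : SL(2, ℤ)) 1 1 : ℤ)).natAbs) = 1 := by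
  have h4' : 2 ^ 2 ∣ N := by simpa using h4
  refine exists_jacobiSym_represents_of_generator_sq_mod f hu hN hm hu₀ hgen (fun z hz ↦ ?_) h4
  have h := pMulLatticeLeGamma1OfTracelessPrime_holds N f hf 2 Nat.prime_two
    ((dvd_pow_self 2 two_ne_zero).trans h4') (hf.cuspCoeff_eq_zero_of_sq_dvd Nat.prime_two h4') z hz
  exact_mod_cast h

end Summit.BirchSwinnertonDyer.BirchSwinnertonDyer.Theorems.ManinLocalTwoThree

end
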